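import Summits.NavierStokesRegularity.FluidComputer.RowSegmentSound
import HarnessLib

/-!
# The k53d chain: the lock coordinate is constant along each segment (read-out, computational)

HONEST FRAMING (cell `pub-fluidc`, blueprint seat bp3, gen 22): low prior, high value-of-information
experiment on Tao's machine paradigm; NOT a claim that NS blows up.

WHAT. The junction check `juncOK` does not compare the lock coordinates `p` of consecutive rows, but
the phase-map construction along a segment (`RowData.segment_members`) needs them equal. On the k53d
chain `p` changes exactly at the two stage switches `656|657` (`1 → 2`) and `986|987` (`2 → 5`); this
file reads that off the chain data of record by `native_decide` (`pOK_all`) and states it per junction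
(`p_const`). COMPUTATIONAL: `native_decide` over `RowChain.allRows`.

[cite: Tao2016AveragedNS, §5.5 Thm 5.3 (5.5)]
-/

namespace Summit.NavierStokesRegularity.FluidComputer

namespace RowChain

open RowCheck

/-- **Read-out**: away from the two stage switches, consecutive rows lock the same coordinate.
[folklore] -/
theorem pOK_all : ((List.range 1065).all fun k =>
    decide (k = 656) || decide (k = 986) || decide ((row (k + 1)).p = (row k).p)) = true := by
  native_decide

/-- The lock coordinate does not change at junction `k|k+1` unless it is a stage switch. [folklore] -/
theorem p_const {k : ℕ} (hk : k + 1 < 1066) (h1 : k ≠ 656) (h2 : k ≠ 986) :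
    (row (k + 1)).p = (row k).p := by
  have h := List.all_eq_true.mp pOK_all k (List.mem_range.mpr (by omega))
  simpa [h1, h2] using h

/-- The three lock coordinates of record: `p = 1` on rows `0–656`, `p = 2` on rows `657–986`,
`p = 5` on rows `987–1065` (stated at the segment heads). [folklore] -/
theorem p_heads : (row 0).p = 1 ∧ (row 657).p = 2 ∧ (row 987).p = 5 := by
  refine ⟨?_, ?_, ?_⟩ <;> native_decide

end RowChain

end Summit.NavierStokesRegularity.FluidComputer
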